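import Literature.Geometry.DiscreteGeometry.TwoShellIntegerModel

/-!
# NODE g79 «CompressedCut», toward the open leaf NS♭₂ — FRAME TRANSFER through a tetrahedral triple (third brick of the FRAME half)

Route `OverbindingBudget` (Crystallization), crux `RobustDefectLimitWindows` (stmt-AtomisticToContinuum-31280), decomp-a2c lens 4, generation 79, ADDENDUM 6.
Companions: `…OverbindingBudgetAffineCompressedCutScale` (SCALE half), `…CompressedCutDict` (the dictionary `v − v_k ↦ w` with
`‖s'·A' w − s·(A v − A v_k)‖ ≤ e`, `e = 2ε·s + ε·s'`), `…CompressedCutClasses` (the dictionary preserves distances and inner products exactly).  This file is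
the LINEAR-ALGEBRA step (memo NODE-g79 §5 (F-c)/(F-d)), stated on the tree's COMMON `√18` INTEGER MODEL of the two-shell patterns
(`Literature.Geometry.DiscreteGeometry.TwoShellIntegerModel`: `fccModelInt`, `hcpModelInt`, `det3Int`, `cramerInt`, `cramerInt_spec`), potential-free:

* §0 bridges (`exists_model_of_mem`, `sqNormInt_eq_of_norm_eq_one`, `sqNormInt_sub_eq_of_dist_eq_one`): pattern points are model vectors over `√18`; norm `1` ⇔
  `sqNormInt = 18`, distance `1` ⇔ `sqNormInt` of the difference `= 18` — so the real-side facts of the Dict/Classes riders feed the integer-side hypotheses below;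
* §1 TETRAHEDRAL TRIPLES, by `decide`: every first-shell vector `a` of either model has first-shell `b, c` with `a, b, c` mutually adjacent (`tetra_exists`); every
  such triple is UNIMODULAR, `det3Int a b c = ±54` = the covolume (`tetra_det`); and the Cramer numerators of every model vector `W` in such a triple satisfy
  `|λ₀| + |λ₁| + |λ₂| ≤ 162 = 3·54` (`tetra_cramer_sum_le`) — so every point of the pattern has coordinates of ℓ¹-size ≤ 3 in any tetrahedral first-shell triple;
* §2 Cramer over `ℝ`: `W/√18 = Σᵢ (λᵢ/d)·Wᵢ/√18` (`model_cramer`);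
* §3 `transfer_three`: three dictionary-type inequalities transfer linearly to any combination, with the ℓ¹-norm of the coefficients;
* §4 ★ `dict_frame_transfer`: if three dictionary entries sit on a tetrahedral triple `W₀, W₁, W₂` of `k`'s model with partners `u₀, u₁, u₂` and tolerance `e`, then for
  EVERY model vector `W` of `k`'s pattern `‖s'·A'(W/√18) − s·A(u_W)‖ ≤ 3e`, `u_W = Σᵢ (λᵢ/d)·uᵢ` explicit — the `k`-frame on all of `P'` is determined by three
  dictionary entries.  (With the Classes rider's Gram preservation, `u_W` is the image of `W/√18` under the linear isometry fixed by the triple; chain iteration = g80.)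

Deps: tree only (`Literature.Geometry.DiscreteGeometry.TwoShellIntegerModel`).  No `instance`, no `notation`, no `set_option`, no new axioms, 0 sorry.
-/

namespace Summit.AtomisticToContinuum.Crystallization.Theorems.OverbindingBudgetAffineCompressedCutTransfer

open Literature.Geometry.DiscreteGeometry (sqNormInt intVec det3Int cramerInt cramerInt_spec fccModelInt hcpModelInt fccTwoShellPattern
  hcpTwoShellPattern fccTwoShellPattern_eq_image hcpTwoShellPattern_eq_image norm_sq_intVec_div dist_sq_intVec_div)

/-! ## §0  Bridges: pattern points ↔ model vectors -/

/-- Every point of a two-shell pattern is a model vector over `√18`, and the pattern is the image of the corresponding model. [this file] -/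
theorem exists_model_of_mem {P : Finset (EuclideanSpace ℝ (Fin 3))} (hP : P = fccTwoShellPattern ∨ P = hcpTwoShellPattern)
    {w : EuclideanSpace ℝ (Fin 3)} (hw : w ∈ P) :
    ∃ S : Finset (Fin 3 → ℤ), (S = fccModelInt ∨ S = hcpModelInt) ∧ P = S.image (fun v => (Real.sqrt 18)⁻¹ • intVec v) ∧
      ∃ W ∈ S, w = (Real.sqrt 18)⁻¹ • intVec W := by
  have key : ∀ {S : Finset (Fin 3 → ℤ)}, P = S.image (fun v => (Real.sqrt (18 : ℕ))⁻¹ • intVec v) →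
      P = S.image (fun v => (Real.sqrt 18)⁻¹ • intVec v) ∧ ∃ W ∈ S, w = (Real.sqrt 18)⁻¹ • intVec W := by
    intro S h
    have h' : P = S.image (fun v => (Real.sqrt 18)⁻¹ • intVec v) := by
      rw [h]; simp only [Nat.cast_ofNat]
    refine ⟨h', ?_⟩
    rw [h'] at hw
    obtain ⟨W, hW, hWw⟩ := Finset.mem_image.1 hw
    exact ⟨W, hW, hWw.symm⟩
  rcases hP with rfl | rfl
  · exact ⟨fccModelInt, Or.inl rfl, key fccTwoShellPattern_eq_image⟩
  · exact ⟨hcpModelInt, Or.inr rfl, key hcpTwoShellPattern_eq_image⟩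

/-- A model vector of norm `1` (a first-shell point) has `sqNormInt = 18`. [this file] -/
theorem sqNormInt_eq_of_norm_eq_one {W : Fin 3 → ℤ} (h : ‖(Real.sqrt 18)⁻¹ • intVec W‖ = 1) : sqNormInt W = 18 := by
  have h2 := norm_sq_intVec_div W
  rw [h, one_pow] at h2
  have h3 : (sqNormInt W : ℝ) = 18 := by linarith [h2, (div_eq_one_iff_eq (by norm_num : (18 : ℝ) ≠ 0)).mp h2.symm]
  exact_mod_cast h3

/-- Two model vectors at distance `1` (adjacent points) differ by a vector of `sqNormInt = 18`. [this file] -/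
theorem sqNormInt_sub_eq_of_dist_eq_one {V W : Fin 3 → ℤ}
    (h : dist ((Real.sqrt 18)⁻¹ • intVec V) ((Real.sqrt 18)⁻¹ • intVec W) = 1) : sqNormInt (V - W) = 18 := by
  have h2 := dist_sq_intVec_div V W
  rw [h, one_pow] at h2
  have h3 : (sqNormInt (V - W) : ℝ) = 18 := by linarith [h2, (div_eq_one_iff_eq (by norm_num : (18 : ℝ) ≠ 0)).mp h2.symm]
  exact_mod_cast h3

/-! ## §1  Tetrahedral first-shell triples in the `√18` models (by `decide`) -/

/-- Every first-shell vector of either model is a vertex of a regular tetrahedron `{0, a, b, c}` of first-shell vectors. [folklore; this file, by `decide`] -/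
theorem tetra_exists {S : Finset (Fin 3 → ℤ)} (hS : S = fccModelInt ∨ S = hcpModelInt) :
    ∀ a ∈ S, sqNormInt a = 18 → ∃ b ∈ S, ∃ c ∈ S,
      sqNormInt b = 18 ∧ sqNormInt c = 18 ∧ sqNormInt (a - b) = 18 ∧ sqNormInt (a - c) = 18 ∧ sqNormInt (b - c) = 18 := by
  rcases hS with rfl | rfl <;> decide

/-- Tetrahedral first-shell triples are UNIMODULAR: `det3Int a b c = ±54`, the covolume of the site lattice in the `√18` model.
[folklore; this file, by `decide`] -/
theorem tetra_det {S : Finset (Fin 3 → ℤ)} (hS : S = fccModelInt ∨ S = hcpModelInt) :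
    ∀ a ∈ S, ∀ b ∈ S, ∀ c ∈ S, sqNormInt a = 18 → sqNormInt b = 18 → sqNormInt c = 18 →
      sqNormInt (a - b) = 18 → sqNormInt (a - c) = 18 → sqNormInt (b - c) = 18 →
      (det3Int a b c = 54 ∨ det3Int a b c = -54) := by
  rcases hS with rfl | rfl <;> decide

/-- Cramer numerators of model vectors in a tetrahedral triple have ℓ¹-size at most `162 = 3·54`. [this file, by `decide`] -/
theorem tetra_cramer_sum_le {S : Finset (Fin 3 → ℤ)} (hS : S = fccModelInt ∨ S = hcpModelInt) :
    ∀ a ∈ S, ∀ b ∈ S, ∀ c ∈ S, sqNormInt a = 18 → sqNormInt b = 18 → sqNormInt c = 18 →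
      sqNormInt (a - b) = 18 → sqNormInt (a - c) = 18 → sqNormInt (b - c) = 18 →
      ∀ w ∈ S, |cramerInt a b c w 0| + |cramerInt a b c w 1| + |cramerInt a b c w 2| ≤ 162 := by
  rcases hS with rfl | rfl <;> decide

/-! ## §2  Cramer's rule over `ℝ` -/

/-- `intVec` is additive. [folklore] -/
private theorem intVec_add' (v w : Fin 3 → ℤ) : intVec (v + w) = intVec v + intVec w := by
  ext i; simp [intVec]

/-- `intVec` commutes with integer scalars. [folklore] -/
private theorem intVec_zsmul' (n : ℤ) (v : Fin 3 → ℤ) : intVec (n • v) = (n : ℝ) • intVec v := by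
  ext i; simp [intVec]

/-- Cramer's rule for real vectors of the integer model: `W = Σᵢ (λᵢ/d)·Wᵢ` when `d = det3Int W₀ W₁ W₂ ≠ 0`. [folklore; this file] -/
theorem intVec_cramer (a b c w : Fin 3 → ℤ) (hd : det3Int a b c ≠ 0) :
    intVec w = ((cramerInt a b c w 0 : ℝ) / det3Int a b c) • intVec a + ((cramerInt a b c w 1 : ℝ) / det3Int a b c) • intVec b
      + ((cramerInt a b c w 2 : ℝ) / det3Int a b c) • intVec c := by
  have h := congrArg intVec (cramerInt_spec a b c w)
  rw [intVec_add', intVec_add', intVec_zsmul', intVec_zsmul', intVec_zsmul', intVec_zsmul'] at h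
  have hd' : (det3Int a b c : ℝ) ≠ 0 := by exact_mod_cast hd
  calc intVec w = (det3Int a b c : ℝ)⁻¹ • ((det3Int a b c : ℝ) • intVec w) := by
        rw [smul_smul, inv_mul_cancel₀ hd', one_smul]
    _ = (det3Int a b c : ℝ)⁻¹ • ((cramerInt a b c w 0 : ℝ) • intVec a + (cramerInt a b c w 1 : ℝ) • intVec b
          + (cramerInt a b c w 2 : ℝ) • intVec c) := by rw [h]
    _ = _ := by simp only [smul_add, smul_smul, div_eq_inv_mul]

/-- The same at the model scale `1/√18`. [this file] -/
theorem model_cramer (a b c w : Fin 3 → ℤ) (hd : det3Int a b c ≠ 0) :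
    (Real.sqrt 18)⁻¹ • intVec w = ((cramerInt a b c w 0 : ℝ) / det3Int a b c) • ((Real.sqrt 18)⁻¹ • intVec a)
      + ((cramerInt a b c w 1 : ℝ) / det3Int a b c) • ((Real.sqrt 18)⁻¹ • intVec b)
      + ((cramerInt a b c w 2 : ℝ) / det3Int a b c) • ((Real.sqrt 18)⁻¹ • intVec c) := by
  rw [intVec_cramer a b c w hd]
  simp only [smul_add, smul_smul, mul_comm ((Real.sqrt 18)⁻¹)]

/-! ## §3  Linear transfer of three dictionary inequalities -/

/-- Three inequalities `‖s'·B' wᵢ − s·B uᵢ‖ ≤ e` transfer to any linear combination with the ℓ¹-norm of the coefficients. [this file] -/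
theorem transfer_three {B B' : EuclideanSpace ℝ (Fin 3) →ₗ[ℝ] EuclideanSpace ℝ (Fin 3)} {s s' e : ℝ}
    {w₀ w₁ w₂ u₀ u₁ u₂ : EuclideanSpace ℝ (Fin 3)}
    (h₀ : ‖s' • B' w₀ - s • B u₀‖ ≤ e) (h₁ : ‖s' • B' w₁ - s • B u₁‖ ≤ e) (h₂ : ‖s' • B' w₂ - s • B u₂‖ ≤ e) (c₀ c₁ c₂ : ℝ) :
    ‖s' • B' (c₀ • w₀ + c₁ • w₁ + c₂ • w₂) - s • B (c₀ • u₀ + c₁ • u₁ + c₂ • u₂)‖ ≤ (|c₀| + |c₁| + |c₂|) * e := by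
  have e1 : s' • B' (c₀ • w₀ + c₁ • w₁ + c₂ • w₂) = c₀ • (s' • B' w₀) + c₁ • (s' • B' w₁) + c₂ • (s' • B' w₂) := by
    simp only [map_add, map_smul, smul_add]
    rw [smul_comm s' c₀, smul_comm s' c₁, smul_comm s' c₂]
  have e2 : s • B (c₀ • u₀ + c₁ • u₁ + c₂ • u₂) = c₀ • (s • B u₀) + c₁ • (s • B u₁) + c₂ • (s • B u₂) := by
    simp only [map_add, map_smul, smul_add]
    rw [smul_comm s c₀, smul_comm s c₁, smul_comm s c₂]
  have e3 : c₀ • (s' • B' w₀) + c₁ • (s' • B' w₁) + c₂ • (s' • B' w₂) - (c₀ • (s • B u₀) + c₁ • (s • B u₁) + c₂ • (s • B u₂))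
      = c₀ • (s' • B' w₀ - s • B u₀) + c₁ • (s' • B' w₁ - s • B u₁) + c₂ • (s' • B' w₂ - s • B u₂) := by
    simp only [smul_sub]; abel
  rw [e1, e2, e3]
  have n1 := norm_add_le (c₀ • (s' • B' w₀ - s • B u₀) + c₁ • (s' • B' w₁ - s • B u₁)) (c₂ • (s' • B' w₂ - s • B u₂))
  have n2 := norm_add_le (c₀ • (s' • B' w₀ - s • B u₀)) (c₁ • (s' • B' w₁ - s • B u₁))
  rw [norm_smul, Real.norm_eq_abs] at n1
  rw [norm_smul, norm_smul, Real.norm_eq_abs, Real.norm_eq_abs] at n2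
  have p0 := mul_le_mul_of_nonneg_left h₀ (abs_nonneg c₀)
  have p1 := mul_le_mul_of_nonneg_left h₁ (abs_nonneg c₁)
  have p2 := mul_le_mul_of_nonneg_left h₂ (abs_nonneg c₂)
  linarith

/-! ## §4  Frame transfer through a tetrahedral triple -/

/-- ★ **FRAME TRANSFER.**  Frames `A` (scale `s`) and `A'` (scale `s'`); three dictionary entries on a tetrahedral first-shell triple `W₀, W₁, W₂` of `k`'s model
`S' ∈ {fccModelInt, hcpModelInt}` with partners `u₀, u₁, u₂` and tolerance `e`.  Then for EVERY vector `W` of `k`'s model, with `λ = cramerInt W₀ W₁ W₂ W` and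
`d = det3Int W₀ W₁ W₂ (= ±54)`:  `‖s'·A'(W/√18) − s·A(Σᵢ (λᵢ/d)·uᵢ)‖ ≤ 3e`. [this file] -/
theorem dict_frame_transfer {S' : Finset (Fin 3 → ℤ)} (hS' : S' = fccModelInt ∨ S' = hcpModelInt)
    {A A' : EuclideanSpace ℝ (Fin 3) →ₗ[ℝ] EuclideanSpace ℝ (Fin 3)} {s s' e : ℝ}
    {W₀ W₁ W₂ : Fin 3 → ℤ} (hW₀ : W₀ ∈ S') (hW₁ : W₁ ∈ S') (hW₂ : W₂ ∈ S')
    (hn₀ : sqNormInt W₀ = 18) (hn₁ : sqNormInt W₁ = 18) (hn₂ : sqNormInt W₂ = 18)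
    (h₀₁ : sqNormInt (W₀ - W₁) = 18) (h₀₂ : sqNormInt (W₀ - W₂) = 18) (h₁₂ : sqNormInt (W₁ - W₂) = 18)
    {u₀ u₁ u₂ : EuclideanSpace ℝ (Fin 3)}
    (hd₀ : ‖s' • A' ((Real.sqrt 18)⁻¹ • intVec W₀) - s • A u₀‖ ≤ e)
    (hd₁ : ‖s' • A' ((Real.sqrt 18)⁻¹ • intVec W₁) - s • A u₁‖ ≤ e)
    (hd₂ : ‖s' • A' ((Real.sqrt 18)⁻¹ • intVec W₂) - s • A u₂‖ ≤ e)
    {W : Fin 3 → ℤ} (hW : W ∈ S') :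
    ‖s' • A' ((Real.sqrt 18)⁻¹ • intVec W)
        - s • A (((cramerInt W₀ W₁ W₂ W 0 : ℝ) / det3Int W₀ W₁ W₂) • u₀ + ((cramerInt W₀ W₁ W₂ W 1 : ℝ) / det3Int W₀ W₁ W₂) • u₁
          + ((cramerInt W₀ W₁ W₂ W 2 : ℝ) / det3Int W₀ W₁ W₂) • u₂)‖ ≤ 3 * e := by
  have hdet := tetra_det hS' W₀ hW₀ W₁ hW₁ W₂ hW₂ hn₀ hn₁ hn₂ h₀₁ h₀₂ h₁₂
  have hsum := tetra_cramer_sum_le hS' W₀ hW₀ W₁ hW₁ W₂ hW₂ hn₀ hn₁ hn₂ h₀₁ h₀₂ h₁₂ W hW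
  have hd : det3Int W₀ W₁ W₂ ≠ 0 := by rcases hdet with h | h <;> rw [h] <;> norm_num
  have habs : |(det3Int W₀ W₁ W₂ : ℝ)| = 54 := by
    rcases hdet with h | h <;> rw [h] <;> norm_num
  have he : 0 ≤ e := (norm_nonneg _).trans hd₀
  rw [model_cramer W₀ W₁ W₂ W hd]
  refine (transfer_three hd₀ hd₁ hd₂ _ _ _).trans ?_
  have hsumR : (|(cramerInt W₀ W₁ W₂ W 0 : ℝ)| + |(cramerInt W₀ W₁ W₂ W 1 : ℝ)| + |(cramerInt W₀ W₁ W₂ W 2 : ℝ)|) ≤ 162 := by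
    have h' : (((|cramerInt W₀ W₁ W₂ W 0| + |cramerInt W₀ W₁ W₂ W 1| + |cramerInt W₀ W₁ W₂ W 2| : ℤ) : ℝ)) ≤ ((162 : ℤ) : ℝ) := by
      exact_mod_cast hsum
    push_cast at h'
    exact h'
  have hcoef : |(cramerInt W₀ W₁ W₂ W 0 : ℝ) / det3Int W₀ W₁ W₂| + |(cramerInt W₀ W₁ W₂ W 1 : ℝ) / det3Int W₀ W₁ W₂|
      + |(cramerInt W₀ W₁ W₂ W 2 : ℝ) / det3Int W₀ W₁ W₂| ≤ 3 := by
    rw [abs_div, abs_div, abs_div, habs]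
    linarith
  exact mul_le_mul_of_nonneg_right hcoef he |>.trans (by linarith)

end Summit.AtomisticToContinuum.Crystallization.Theorems.OverbindingBudgetAffineCompressedCutTransfer
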